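import Mathlib
import Summits.RiemannHypothesis.RiemannHypothesis.Theorems.HandoffSplitKernel
import HarnessLib

/-!
# THEOREM V for a general split kernel (handoff prove-1, ATTEMPT-15 §4.2, «V-1», part 2/2)

Continues `HandoffSplitKernel`: the LOW part `G₁ = K ⋆ φ` of the split is read on the zero side
under `RHUpTo T₀`, keeping the verified Gram form
`𝒱_φ(g) = Σ_{ρ ∈ weilZeroIndex T₀} m(ρ) |ĝ(1/2 + iγ)|² Φ(γ)` and bounding the unverified zeros by the
kernel's STRIP DECAY `‖φ̂(ρ)‖ ≤ D² / |Im ρ|^{2(k+1)}` (a hypothesis; for Solo's mollifier kernel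
`D = D_{k+1}(ψ)`).  Result (`weilQuadratic_re_ge_verifiedGramK`): under `RHUpTo T₀` and
`log π + 2 S(2a + δ) + c ≤ Re ψ(1/4 + ih/2)`,
`Re W(g ⋆ g̃) ≥ 𝒱_φ(g) + c M_φ(g) - τ_φ ‖g‖₂²`,
`τ_φ = 8 log 2 · A₁ · a e^a D² / T₀^{2k} + (W_h - W_0) θ + 4 p a e^a` (`splitTariff`), and the
REDUCTION `weilPositivityOn_of_rhUpTo_of_nearNullSamplingK`: Weil positivity on `[-a, a]` from
`RHUpTo T₀` and the RH-free inequality `NearNullSamplingK` (posited, not proved).  With flat,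
polar-exact, Gevrey kernels every term of `τ_φ` is super-exponentially small (ATTEMPT-15 §4.2, N3b),
which is what makes the sampling hypothesis plausible beyond `a = (log 3)/2`; the existence of
such kernels is a paper construction, NOT formalised here.  `IsMollifier.isSplitKernel_mollKernel`
records that Solo's kernel is a split kernel, so THEOREM V is the special case
`θ = δ²h², p = e^δ - 1, D = D_{k+1}(ψ)`.  Nothing in this file bears on the truth of RH.
-/

set_option linter.dupNamespace false

open scoped ContDiff ComplexConjugate Real Topology
open Complex MeasureTheory Set Filter Literature.NumberTheory.LFunctions
  Literature.Analysis.SpecialFunctions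

namespace Summit.RiemannHypothesis.RiemannHypothesis.Theorems

variable {g φ : ℝ → ℂ} {a δ : ℝ}

/-! ### The low part with strip decay `(D, k)` -/

/-- `‖Ĝ₁(ρ)‖ ≤ e^a ‖g‖₁² · D² / |Im ρ|^{2(k+1)}` in the closed strip, given the kernel's decay. -/
theorem norm_weilMellin_lowPartK_strip_le (hg : IsWeilTest g) (ha : 0 ≤ a)
    (hsupp : tsupport g ⊆ Icc (-a) a) (hφ : IsSplitKernel φ δ) {D : ℝ} {k : ℕ}
    (hD : ∀ ρ : ℂ, 0 ≤ ρ.re → ρ.re ≤ 1 → ρ.im ≠ 0 → ‖weilMellin φ ρ‖ ≤ D ^ 2 / |ρ.im| ^ (2 * (k + 1)))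
    {ρ : ℂ} (h0 : 0 ≤ ρ.re) (h1 : ρ.re ≤ 1) (him : ρ.im ≠ 0) :
    ‖weilMellin (lowPartK g φ) ρ‖ ≤
      Real.exp a * weilNorm1 g ^ 2 * D ^ 2 / |ρ.im| ^ (2 * (k + 1)) := by
  rw [weilMellin_lowPartK hg hφ, norm_mul]
  have h1' := norm_weilMellin_autoCorr_strip_le hg ha hsupp h0 h1
  have h2' := hD ρ h0 h1 him
  have hA0 : 0 ≤ Real.exp a * weilNorm1 g ^ 2 := by positivity
  calc ‖weilMellin (autoCorr g) ρ‖ * ‖weilMellin φ ρ‖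
      ≤ (Real.exp a * weilNorm1 g ^ 2) * (D ^ 2 / |ρ.im| ^ (2 * (k + 1))) :=
        mul_le_mul h1' h2' (norm_nonneg _) hA0
    _ = _ := by ring

/-- The low error with the kernel's decay constant: `E = 4 log 2 · A₁ · e^a ‖g‖₁² · D² / T₀^{2k}`. -/
noncomputable def lowErrK (g : ℝ → ℂ) (a T₀ D : ℝ) (k : ℕ) : ℝ :=
  4 * Real.log 2 * zetaDensityConst * (Real.exp a * weilNorm1 g ^ 2) * D ^ 2 / T₀ ^ (2 * k)

/-- **Low part, partial sums, general kernel.** Under `RHUpTo T₀`, `1 ≤ T₀ ≤ T`: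
`𝒱_φ(g) - E ≤ Re Σ_{ρ ∈ weilZeroIndex T} m(ρ) Ĝ₁(ρ)`. -/
theorem re_weilZeroSidePartial_lowPartK_ge (hg : IsWeilTest g) (ha : 0 ≤ a)
    (hsupp : tsupport g ⊆ Icc (-a) a) (hφ : IsSplitKernel φ δ) {D : ℝ} {k : ℕ}
    (hD : ∀ ρ : ℂ, 0 ≤ ρ.re → ρ.re ≤ 1 → ρ.im ≠ 0 → ‖weilMellin φ ρ‖ ≤ D ^ 2 / |ρ.im| ^ (2 * (k + 1)))
    {T₀ : ℝ} (hT₀ : 1 ≤ T₀) (hRH : RHUpTo T₀) {T : ℝ} (hT : T₀ ≤ T) :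
    verifiedGramK g φ T₀ - lowErrK g a T₀ D k ≤ (weilZeroSidePartial (lowPartK g φ) T).re := by
  set A : ℝ := Real.exp a * weilNorm1 g ^ 2 with hA
  have hA0 : 0 ≤ A := by positivity
  set M : ℝ := 2 * A * D ^ 2 / T₀ ^ (2 * k) with hM
  have hT₀pos : 0 < T₀ := by linarith
  have hM0 : 0 ≤ M := by positivity
  set F : ℂ → ℝ := fun ρ ↦ if T₀ < |ρ.im| then A * D ^ 2 / |ρ.im| ^ (2 * (k + 1)) else 0 with hF
  have hF0 : ∀ ρ, 0 ≤ F ρ := fun ρ ↦ by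
    simp only [hF]; split_ifs <;> positivity
  have hFker : ∀ ρ : ℂ, 0 ≤ ρ.re → ρ.re ≤ 1 → F ρ ≤ M / (1 + (ρ.im - 0) ^ 2) := by
    intro ρ _ _
    rw [sub_zero]
    simp only [hF]
    split_ifs with hγ
    · have hγpos : 0 < |ρ.im| := by linarith
      have hγ1 : 1 ≤ ρ.im ^ 2 := by
        rw [← sq_abs]; nlinarith
      rw [hM, div_le_div_iff₀ (by positivity) (by positivity)]
      have hpow : T₀ ^ (2 * k) ≤ |ρ.im| ^ (2 * k) :=
        pow_le_pow_left₀ hT₀pos.le hγ.le _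
      have e : |ρ.im| ^ (2 * (k + 1)) = |ρ.im| ^ (2 * k) * ρ.im ^ 2 := by
        rw [show 2 * (k + 1) = 2 * k + 2 by ring, pow_add, sq_abs]
      rw [e]
      have hX : 0 ≤ A * D ^ 2 := by positivity
      have hq : 1 ≤ |ρ.im| ^ (2 * k) / T₀ ^ (2 * k) := by
        rw [le_div_iff₀ (by positivity), one_mul]; exact hpow
      calc A * D ^ 2 * (1 + ρ.im ^ 2)
          ≤ A * D ^ 2 * (2 * ρ.im ^ 2) * (|ρ.im| ^ (2 * k) / T₀ ^ (2 * k)) := by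
            have h1 : A * D ^ 2 * (1 + ρ.im ^ 2) ≤ A * D ^ 2 * (2 * ρ.im ^ 2) :=
              mul_le_mul_of_nonneg_left (by linarith) hX
            have h2 : 0 ≤ A * D ^ 2 * (2 * ρ.im ^ 2) := by positivity
            nlinarith
        _ = 2 * A * D ^ 2 / T₀ ^ (2 * k) * (|ρ.im| ^ (2 * k) * ρ.im ^ 2) := by ring
    · positivity
  have hmaj := finsum_weilZeroIndex_le_of_kernel_bound_eff F M 0 hM0 hFker T
  rw [abs_zero, zero_add] at hmaj
  set P : ℂ → ℝ := fun ρ ↦ if |ρ.im| ≤ T₀ then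
      (riemannZetaZeroOrder ρ : ℝ) * lowLineDensityK g φ ρ.im else 0 with hP
  have hfin := weilZeroIndex_finite T
  have hfin₀ := weilZeroIndex_finite T₀
  have hmem : ∀ ρ, ρ ∈ hfin.toFinset ↔ ρ ∈ weilZeroIndex T := fun ρ ↦ hfin.mem_toFinset
  have hmem₀ : ∀ ρ, ρ ∈ hfin₀.toFinset ↔ ρ ∈ weilZeroIndex T₀ := fun ρ ↦ hfin₀.mem_toFinset
  have hpt : ∀ ρ ∈ hfin.toFinset,
      P ρ - (riemannZetaZeroOrder ρ : ℝ) * F ρ ≤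
        ((riemannZetaZeroOrder ρ : ℂ) * weilMellin (lowPartK g φ) ρ).re := by
    intro ρ hρ
    obtain ⟨hz, h0, h1, him, _⟩ := (hmem ρ).1 hρ
    have hm0 : (0 : ℝ) ≤ riemannZetaZeroOrder ρ := by
      exact_mod_cast riemannZetaZeroOrder_nonneg (fun h ↦ him (by rw [h]; simp))
    rw [← Complex.ofReal_intCast, Complex.re_ofReal_mul]
    by_cases hγ : T₀ < |ρ.im|
    · have hP' : P ρ = 0 := by simp only [hP, if_neg (not_le.2 hγ)]
      have hF' : F ρ = A * D ^ 2 / |ρ.im| ^ (2 * (k + 1)) := by simp only [hF, if_pos hγ]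
      have hn : ‖weilMellin (lowPartK g φ) ρ‖ ≤ A * D ^ 2 / |ρ.im| ^ (2 * (k + 1)) := by
        rw [hA]; exact norm_weilMellin_lowPartK_strip_le hg ha hsupp hφ hD h0 h1 him
      have hre := neg_le_abs (weilMellin (lowPartK g φ) ρ).re
      have habs := Complex.abs_re_le_norm (weilMellin (lowPartK g φ) ρ)
      rw [hP', hF', zero_sub]
      nlinarith
    · push Not at hγ
      have hre : ρ.re = 1 / 2 := hRH.re_eq hz him hγ
      have eρ : ρ = 1 / 2 + ρ.im * I := by
        apply Complex.ext <;> simp [hre]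
      have hval : (weilMellin (lowPartK g φ) ρ).re = lowLineDensityK g φ ρ.im := by
        rw [eρ, weilMellin_lowPartK_half_line hg hφ, Complex.ofReal_re]; simp
      have hP' : P ρ = (riemannZetaZeroOrder ρ : ℝ) * lowLineDensityK g φ ρ.im := by
        simp only [hP, if_pos hγ]
      have hF' : F ρ = 0 := by simp only [hF, if_neg (not_lt.2 hγ)]
      rw [hval, hP', hF', mul_zero, sub_zero]
  have hPsum : ∑ ρ ∈ hfin.toFinset, P ρ = verifiedGramK g φ T₀ := by
    have hsplit : ∑ ρ ∈ hfin.toFinset, P ρ =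
        ∑ ρ ∈ hfin.toFinset.filter (fun ρ ↦ |ρ.im| ≤ T₀),
          (riemannZetaZeroOrder ρ : ℝ) * lowLineDensityK g φ ρ.im := by
      rw [Finset.sum_filter]
    have hset : hfin.toFinset.filter (fun ρ ↦ |ρ.im| ≤ T₀) = hfin₀.toFinset := by
      ext ρ
      rw [Finset.mem_filter, hmem, hmem₀]
      simp only [weilZeroIndex, mem_setOf_eq]
      constructor
      · rintro ⟨⟨hz, h0, h1, him, -⟩, hle⟩; exact ⟨hz, h0, h1, him, hle⟩
      · rintro ⟨hz, h0, h1, him, hle⟩; exact ⟨⟨hz, h0, h1, him, hle.trans hT⟩, hle⟩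
    rw [hsplit, hset, verifiedGramK, finsum_mem_eq_finite_toFinset_sum _ hfin₀]
  unfold weilZeroSidePartial
  rw [finsum_mem_eq_finite_toFinset_sum _ hfin, Complex.re_sum]
  rw [finsum_mem_eq_finite_toFinset_sum _ hfin] at hmaj
  have hsum := Finset.sum_le_sum hpt
  rw [Finset.sum_sub_distrib, hPsum] at hsum
  have hE : lowErrK g a T₀ D k = 2 * zetaDensityConst * M * Real.log 2 := by
    rw [lowErrK, hM]; ring
  rw [hE]
  linarith

/-- **Low part, general kernel.** Under `RHUpTo T₀`, `T₀ ≥ 1`: `𝒱_φ(g) - E ≤ Re W(G₁)`. -/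
theorem weilFunctional_lowPartK_re_ge (hg : IsWeilTest g) (ha : 0 ≤ a)
    (hsupp : tsupport g ⊆ Icc (-a) a) (hφ : IsSplitKernel φ δ) {D : ℝ} {k : ℕ}
    (hD : ∀ ρ : ℂ, 0 ≤ ρ.re → ρ.re ≤ 1 → ρ.im ≠ 0 → ‖weilMellin φ ρ‖ ≤ D ^ 2 / |ρ.im| ^ (2 * (k + 1)))
    {T₀ : ℝ} (hT₀ : 1 ≤ T₀) (hRH : RHUpTo T₀) :
    verifiedGramK g φ T₀ - lowErrK g a T₀ D k ≤ (weilFunctional (lowPartK g φ)).re := by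
  have hG₁ := isWeilTest_lowPartK hg hφ
  have hlim : Tendsto (fun T ↦ (weilZeroSidePartial (lowPartK g φ) T).re) atTop
      (𝓝 (weilFunctional (lowPartK g φ)).re) :=
    (Complex.continuous_re.tendsto _).comp (explicit_formula_holds hG₁)
  exact ge_of_tendsto hlim ((eventually_ge_atTop T₀).mono fun T hT ↦
    re_weilZeroSidePartial_lowPartK_ge hg ha hsupp hφ hD hT₀ hRH hT)

/-! ### THEOREM V for a general kernel, and the reduction -/

/-- The **split tariff** `τ_φ = 8 log 2 · A₁ · a e^a D² / T₀^{2k} + (W_h - W_0) θ + 4 p a e^a`. -/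
noncomputable def splitTariff (a T₀ h θ p D : ℝ) (k : ℕ) : ℝ :=
  8 * Real.log 2 * zetaDensityConst * a * Real.exp a * D ^ 2 / T₀ ^ (2 * k)
    + (reDigammaQuarter h - reDigammaQuarter 0) * θ + 4 * p * a * Real.exp a

/-- **THEOREM V (general kernel).** Under `RHUpTo T₀` (`T₀ ≥ 1`), `a > 0`, a split kernel `φ` of radius
`δ` with transparency `θ` on `|t| < |h|`, polar defect `p` and strip decay `(D, k)`, and the margin
condition `log π + 2 S(2a + δ) + c ≤ Re ψ(1/4 + ih/2)`:
`Re W(g ⋆ g̃) ≥ 𝒱_φ(g) + c · M_φ(g) - τ_φ ‖g‖₂²`. -/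
theorem weilQuadratic_re_ge_verifiedGramK (hg : IsWeilTest g) (ha : 0 < a)
    (hsupp : tsupport g ⊆ Icc (-a) a) (hφ : IsSplitKernel φ δ) {T₀ : ℝ} (hT₀ : 1 ≤ T₀)
    (hRH : RHUpTo T₀) {h c θ p D : ℝ} {k : ℕ} (hθ0 : 0 ≤ θ)
    (hθ : ∀ t : ℝ, |t| < |h| → 1 - lineSymbol φ t ≤ θ) (hp : 0 ≤ p)
    (hp0 : ‖1 - weilMellin φ 0‖ ≤ p) (hp1 : ‖1 - weilMellin φ 1‖ ≤ p)
    (hD : ∀ ρ : ℂ, 0 ≤ ρ.re → ρ.re ≤ 1 → ρ.im ≠ 0 → ‖weilMellin φ ρ‖ ≤ D ^ 2 / |ρ.im| ^ (2 * (k + 1)))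
    (hh : Real.log π + 2 * primeSum (2 * a + δ) + c ≤ reDigammaQuarter h) :
    verifiedGramK g φ T₀ + c * highMassK g φ - splitTariff a T₀ h θ p D k * weilNorm2Sq g ≤
      (weilQuadratic g).re := by
  have hG₁ := isWeilTest_lowPartK hg hφ
  have hG₂ := isWeilTest_highPartK hg hφ
  have hsplit : weilQuadratic g =
      weilFunctional (lowPartK g φ) + weilFunctional (highPartK g φ) := by
    rw [← weilFunctional_add hG₁ hG₂, lowPartK_add_highPartK]; rfl
  have h1 := weilFunctional_lowPartK_re_ge hg ha.le hsupp hφ hD hT₀ hRH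
  have h2 := weilFunctional_highPartK_re_ge hg hsupp hφ hθ0 hθ hp0 hp1 hh
  have hX := weilNorm1_sq_le hg ha hsupp
  have hT₀pos : 0 < T₀ := by linarith
  have hA₁ := zetaDensityConst_pos
  have hl2 : 0 ≤ Real.log 2 := Real.log_nonneg (by norm_num)
  have hc₁ : 0 ≤ 4 * Real.log 2 * zetaDensityConst * Real.exp a * D ^ 2 := by positivity
  have hlow : lowErrK g a T₀ D k ≤
      8 * Real.log 2 * zetaDensityConst * a * Real.exp a * D ^ 2 / T₀ ^ (2 * k) * weilNorm2Sq g := by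
    have := mul_le_mul_of_nonneg_left hX hc₁
    calc lowErrK g a T₀ D k
        = 4 * Real.log 2 * zetaDensityConst * Real.exp a * D ^ 2 * weilNorm1 g ^ 2 /
            T₀ ^ (2 * k) := by rw [lowErrK]; ring
      _ ≤ 4 * Real.log 2 * zetaDensityConst * Real.exp a * D ^ 2 * (2 * a * weilNorm2Sq g) /
            T₀ ^ (2 * k) := div_le_div_of_nonneg_right this (by positivity)
      _ = _ := by ring
  have hpol : 2 * p * (Real.exp a * weilNorm1 g ^ 2) ≤ 4 * p * a * Real.exp a * weilNorm2Sq g := by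
    have hc : 0 ≤ 2 * p * Real.exp a := by positivity
    have := mul_le_mul_of_nonneg_left hX hc
    nlinarith
  rw [hsplit, Complex.add_re]
  unfold splitTariff
  nlinarith

/-- The **near-null sampling hypothesis for a general kernel**: `τ_φ ‖g‖₂² ≤ 𝒱_φ(g) + c M_φ(g)`
for every window test `g`.  A DEFINITION used only as an explicit hypothesis of the reduction
below — posited, not a fact and not a published result (handoff/prove-1/ATTEMPT-15.md §5). [folklore] -/
def NearNullSamplingK (a : ℝ) (φ : ℝ → ℂ) (T₀ h c θ p D : ℝ) (k : ℕ) : Prop :=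
  ∀ g : ℝ → ℂ, IsWeilTest g → tsupport g ⊆ Icc (-a) a →
    splitTariff a T₀ h θ p D k * weilNorm2Sq g ≤ verifiedGramK g φ T₀ + c * highMassK g φ

/-- **The reduction, general kernel.** `RHUpTo T₀` and `NearNullSamplingK` (with a split kernel
realising the parameters `θ, p, D, k` and the margin condition at height `h`) give Weil positivity
on the window `[-a, a]`. -/
theorem weilPositivityOn_of_rhUpTo_of_nearNullSamplingK (ha : 0 < a) (hφ : IsSplitKernel φ δ)
    {T₀ : ℝ} (hT₀ : 1 ≤ T₀) (hRH : RHUpTo T₀) {h c θ p D : ℝ} {k : ℕ} (hθ0 : 0 ≤ θ)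
    (hθ : ∀ t : ℝ, |t| < |h| → 1 - lineSymbol φ t ≤ θ) (hp : 0 ≤ p)
    (hp0 : ‖1 - weilMellin φ 0‖ ≤ p) (hp1 : ‖1 - weilMellin φ 1‖ ≤ p)
    (hD : ∀ ρ : ℂ, 0 ≤ ρ.re → ρ.re ≤ 1 → ρ.im ≠ 0 → ‖weilMellin φ ρ‖ ≤ D ^ 2 / |ρ.im| ^ (2 * (k + 1)))
    (hh : Real.log π + 2 * primeSum (2 * a + δ) + c ≤ reDigammaQuarter h)
    (hNNS : NearNullSamplingK a φ T₀ h c θ p D k) : WeilPositivityOn a := by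
  intro g hg hsupp
  have h1 := weilQuadratic_re_ge_verifiedGramK hg ha hsupp hφ hT₀ hRH hθ0 hθ hp hp0 hp1 hD hh
  have h2 := hNNS g hg hsupp
  linarith

/-! ### Solo's mollifier kernel is a split kernel with the T42 parameters -/

/-- `ψc ⋆ ψ̃c` for a mollifier profile `ψ` of radius `δ` is a split kernel of radius `2δ`. -/
theorem IsMollifier.isSplitKernel_mollKernel {ψ : ℝ → ℝ} (hψ : IsMollifier ψ δ) :
    IsSplitKernel (mollKernel ψ) (2 * δ) where
  test := hψ.isWeilTest_mollKernel
  supp := by simpa [two_mul] using hψ.tsupport_mollKernel_subset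
  radius_nonneg := by linarith [hψ.radius_nonneg]
  line_im t := by rw [hψ.weilMellin_mollKernel_half_line, Complex.ofReal_im]
  line_nonneg t := by
    rw [hψ.weilMellin_mollKernel_half_line, Complex.ofReal_re]; positivity
  line_le_one t := by
    rw [hψ.weilMellin_mollKernel_half_line, Complex.ofReal_re]
    have := hψ.norm_weilMellin_half_line_le_one t
    have h0 : 0 ≤ ‖weilMellin (mollC ψ) (1 / 2 + t * I)‖ := norm_nonneg _
    nlinarith

end Summit.RiemannHypothesis.RiemannHypothesis.Theorems
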